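import Summits.QuantumFields.BalabanUV.T4Continuum.Support.NE7K1LinSchurLineU1Set
import Summits.QuantumFields.BalabanUV.T4Continuum.Support.NE7K1LinTwoRunMonotone

/-!
# NE7K1LinRegionLine — row NE7 (node U5), candidate route HOM, path H1L, cell K1-lin(s): THE TWO-CUTOFF LINE ON B4's REGIONS —
# for EVERY finite set `Ω^{(j)}` of unit labels, the line `T^Ω(s)` on the fine Neumann region `B^j(Ω^{(j)})` (b04's index
# `↥(fineDom n Ω)`), its `s = 0` end `= fineOpR n a 0 (fineDom n Ω)` (Bałaban's (1.6) at `A = 0`, `m² = 0`), the Löwner lever,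
# the inverse-antitone lever, and the BLOCK–BLOCK PAIRING BOUND of its propagator (B4 (2.30) first pairing ∕ the (5.4) input)

Lineage `b2b-balaban-t4-ne7-p2` (CRUX PROVER NE7 #2), generation 78; file 87.  NEEDS-ESTIMATE #E1 (o3-Ω): the region layer.
PRICING-NE7 v39 N-40-6 (α) «DEFINITIONAL STEP FIRST»: B4's `G_k(Ω, A)` imposes `Ω`'s conditions on the FINE LOCAL operator.  HERE:
`regLine L hn Ω a s` := the tree's `NE7K1LinSchurLineU1.twoCutoffLine` for run B's fine region `R′ = fineDom L (fineDom n Ω)` — i.e.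
`(1−s)·fineOpR n a 0 (fineDom n Ω) + s·Schur_ψ[fineOpR (nL) a 0 (fineDom L (fineDom n Ω))` in block coordinates`]`: BOTH runs are
Bałaban's LOCAL Neumann operators (1.6) OF THE REGION (bonds inside `B^j(Ω)` resp. `B^{j+1}(Ω)`, block averaging term, `A = 0`,
`m² = 0`), run B one level down, then the hard Schur complement over the in-block fluctuations; nothing is defined by restricting a
non-local effective operator.  Transported to b04's index `↥(fineDom n Ω)` along `image_blk_fineDom` (`regEquiv`), exactly as file
80's `boxLine` was transported along `image_fineBox`.

* §1 `regEquiv`, **`regLine`**, `regLine_form`, **`regLine_zero`** `= fineOpR n a 0 (fineDom n Ω)`, `regLine_coercive` (`min(2,a)`),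
  **`fineOpR_form_le_regLine`** (THE LÖWNER LEVER, `twoCutoffLine_form_mono`), `regLine_isUnit_det ∕ _mul_inv ∕ _isSymm ∕ _inv_isSymm`,
  `regLine_inv_form_nonneg`, **`regLine_inv_form_le`** (THE INVERSE-ANTITONE LEVER `⟨g,(T^Ω(s))⁻¹g⟩ ≤ ⟨g, G_j(Ω,0)g⟩`,
  `twoCutoff_inv_form_antitone`).
* §2 **`regLine_inv_setDecay`** (file 86 transported: `Σ_{x∈S}((T^Ω(s))⁻¹g)(x)² ≤ (2∕σ)²e^{−2δρ₀}Σg²`, `σ = min(2,a)∕L^{d+1}`, every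
  `s ∈ [0,1]`, every mesh, every `Ω`) and **`regLine_blockPairing_bound`**:
  `|Σ_{x∈B(y)}Σ_{x′∈B(y′)}(T^Ω(s))⁻¹(x,x′)| ≤ n^{d+1}·(2∕σ)·e^{δ}·e^{−δ|y−y′|_∞}` (b04's `B4RegionCov1518.blockPairing_bound` with
  `G_j(Ω,0) ↦ (T^Ω(s))⁻¹`) — the (5.4) input for file 89.

* §3 **`lineRate d L a₋ a₊`** `= min(1, (min(2,a₋)∕L^{d+1})∕(8(d+1)L² + 8|a₊|))`: ONE rate admissible for the window at every
  `a ∈ [a₋,a₊]` (`lineRate_pos ∕ _le_one ∕ _small`).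

Constants: `σ = min(2,a)∕L^{d+1}` and the window `2(2(d+1)(δL)² + a(e^δ−1)) ≤ σ∕2` — `(d, L, a)` only; no `s`, `n`, `Ω`.
HONEST FRAMING: [folklore]; A = 0; Neumann regions (B4's `G_k(Ω, A)` geometry; no Dirichlet data); nothing printed asserted; no
`sorry`.  Census only; NE7 NOT PRINTED ∕ NOT PROVED; spine 0∕9; FIXED FINITE T⁴, rung (B)+1; NOT infinite volume, NOT mass gap, NOT Clay.
HONEST DEPENDENCY: continuum YM on T⁴ ⇐ BetaPertH ∧ nine spine estimates (0/9 proved); BetaPertH ⇐ (D1) ∧ (D4) ∧ CAP+tail; G-an2-4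
gates asym, D1 and NE2/3/4.
-/

noncomputable section

open Finset Matrix

namespace Summit.QuantumFields.BalabanUV.T4Continuum.NE7K1LinRegionLine

open Literature.MathematicalPhysics.QuantumFieldTheory.Balaban1983to89
open Literature.MathematicalPhysics.QuantumFieldTheory.Balaban1983to89.B4ContourShift (supNorm supNorm_nonneg)
open Literature.MathematicalPhysics.QuantumFieldTheory.Balaban1983to89.B4Reflection242
open Literature.MathematicalPhysics.QuantumFieldTheory.Balaban1983to89.B4BoxCov237
open Literature.MathematicalPhysics.QuantumFieldTheory.Balaban1983to89.B4Lower18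
open Literature.MathematicalPhysics.QuantumFieldTheory.Balaban1983to89.B4Green244 (finePt)
open Literature.MathematicalPhysics.QuantumFieldTheory.Balaban1983to89.B4Prop31Zero (indR finePt_mem_fineDom card_filter_blkR
  image_blk_fineDom)
open Literature.MathematicalPhysics.QuantumFieldTheory.Balaban1983to89.B4RegionCov1518 (edistR_ge_supNorm_blk)
open NE7K1LinSchurLineForm NE7K1LinSchurLineU1 NE7K1LinTwoRunUpper NE7K1LinTwoRunMonotone NE7K1LinSchurLineU1Set
open NE7K1LinInvAntitone

variable {d : ℕ}

/-! ### §1 The region line on b04's index type -/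

section Line

variable {n : ℕ} (L : ℕ) [NeZero L] {Ω : Finset (Fin (d + 1) → ℤ)}

/-- run B's fine region over `Ω` is a union of `nL`-blocks (file 86, in the `NeZero` form). [folklore] -/
theorem fineReg_isBlockUnion (hn : 1 ≤ n) (Ω : Finset (Fin (d + 1) → ℤ)) :
    IsBlockUnion (n * L) (fineDom L (fineDom n Ω)) :=
  isBlockUnion_fineDom_fineDom hn (NeZero.one_le : 1 ≤ L) Ω

/-- the `L`-block labels of run B's fine region ARE run A's fine region `fineDom n Ω`, as an equivalence of index types.
[folklore] -/
def regEquiv (n L : ℕ) [NeZero L] (Ω : Finset (Fin (d + 1) → ℤ)) :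
    ↥((fineDom L (fineDom n Ω)).image (blk L)) ≃ ↥(fineDom n Ω) :=
  Equiv.subtypeEquivRight (fun x => by rw [image_blk_fineDom_fineDom (NeZero.one_le : 1 ≤ L) Ω])

/-- **THE REGION LINE** `T^Ω(s) = twoCutoffLine(n, a, s)` of the fine Neumann region over `Ω`, transported to `↥(fineDom n Ω)`.
[folklore] -/
def regLine (hn : 1 ≤ n) (Ω : Finset (Fin (d + 1) → ℤ)) (a s : ℝ) :
    Matrix ↥(fineDom n Ω) ↥(fineDom n Ω) ℝ :=
  Matrix.reindex (regEquiv n L Ω) (regEquiv n L Ω)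
    (twoCutoffLine (isBlockUnion_fine (fineReg_isBlockUnion L hn Ω)) n a s)

/-- forms transport along the reindexing. [folklore] -/
theorem regLine_form (hn : 1 ≤ n) (a s : ℝ) (v : ↥(fineDom n Ω) → ℝ) :
    v ⬝ᵥ (regLine L hn Ω a s).mulVec v =
      (v ∘ regEquiv n L Ω) ⬝ᵥ (twoCutoffLine (isBlockUnion_fine (fineReg_isBlockUnion L hn Ω)) n a s).mulVec
        (v ∘ regEquiv n L Ω) := by
  simp only [dotProduct, Matrix.mulVec, regLine, Matrix.reindex_apply, Matrix.submatrix_apply, Function.comp]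
  rw [← Equiv.sum_comp (regEquiv n L Ω)]
  refine Finset.sum_congr rfl fun x _ => ?_
  rw [← Equiv.sum_comp (regEquiv n L Ω)]
  simp only [Equiv.symm_apply_apply]

/-- `mulVec` transports along the reindexing. [folklore] -/
theorem reindex_mulVec_apply (A : Matrix ↥((fineDom L (fineDom n Ω)).image (blk L)) ↥((fineDom L (fineDom n Ω)).image (blk L)) ℝ)
    (g : ↥(fineDom n Ω) → ℝ) (x : ↥(fineDom n Ω)) :
    (Matrix.reindex (regEquiv n L Ω) (regEquiv n L Ω) A).mulVec g x = A.mulVec (g ∘ regEquiv n L Ω) ((regEquiv n L Ω).symm x) := by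
  simp only [Matrix.mulVec, dotProduct, Matrix.reindex_apply, Matrix.submatrix_apply, Function.comp]
  rw [← Equiv.sum_comp (regEquiv n L Ω)]
  simp only [Equiv.symm_apply_apply]

/-- the square norm transports. [folklore] -/
theorem normSq_comp_regEquiv (v : ↥(fineDom n Ω) → ℝ) :
    (v ∘ regEquiv n L Ω) ⬝ᵥ (v ∘ regEquiv n L Ω) = v ⬝ᵥ v := by
  simp only [dotProduct, Function.comp]
  exact Equiv.sum_comp (regEquiv n L Ω) (fun x => v x * v x)

/-- **AT `s = 0` THE REGION LINE IS BAŁABAN'S (1.6) AT `A = 0` ON THE REGION**: `regLine(n, a, 0) = fineOpR n a 0 (fineDom n Ω)`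
(run A). [folklore] -/
theorem regLine_zero (hn : 1 ≤ n) (a : ℝ) : regLine L hn Ω a 0 = fineOpR n a 0 (fineDom n Ω) := by
  have h0 : twoCutoffLine (isBlockUnion_fine (fineReg_isBlockUnion L hn Ω)) n a 0 =
      runA n L a (fineDom L (fineDom n Ω)) := twoCutoffLine_zero _ n a
  ext x y
  simp only [regLine, Matrix.reindex_apply, Matrix.submatrix_apply, h0, runA, fineOpR, regionOpR, Matrix.of_apply]
  have hx : ((regEquiv n L Ω).symm x).1 = x.1 := rfl
  have hy : ((regEquiv n L Ω).symm y).1 = y.1 := rfl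
  rw [hx, hy, image_blk_fineDom_fineDom (NeZero.one_le : 1 ≤ L) Ω]

/-- coercivity of the region line: `min(2,a)‖v‖² ≤ ⟨v, T^Ω(s)v⟩` for `a > 0`, `s ≥ 0`. [folklore] -/
theorem regLine_coercive (hn : 1 ≤ n) {a : ℝ} (ha : 0 < a) {s : ℝ} (hs : 0 ≤ s) (v : ↥(fineDom n Ω) → ℝ) :
    min 2 a * (v ⬝ᵥ v) ≤ v ⬝ᵥ (regLine L hn Ω a s).mulVec v := by
  rw [regLine_form, ← normSq_comp_regEquiv L v]
  exact twoCutoffLine_coercive_sharp hn (fineReg_isBlockUnion L hn Ω) ha hs _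

/-- the form of the region line is nonnegative. [folklore] -/
theorem regLine_form_nonneg (hn : 1 ≤ n) {a : ℝ} (ha : 0 < a) {s : ℝ} (hs : 0 ≤ s) (v : ↥(fineDom n Ω) → ℝ) :
    0 ≤ v ⬝ᵥ (regLine L hn Ω a s).mulVec v :=
  le_trans (mul_nonneg (lt_min (by norm_num) ha).le (Finset.sum_nonneg fun i _ => mul_self_nonneg (v i)))
    (regLine_coercive L hn ha hs v)

/-- **THE LÖWNER LEVER**: `⟨g, G_j(Ω,0)⁻¹ g⟩ = ⟨g, fineOpR(n,a,0) g⟩ ≤ ⟨g, T^Ω(s) g⟩` for every `s ≥ 0`. [folklore] -/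
theorem fineOpR_form_le_regLine (hn : 1 ≤ n) {a : ℝ} (ha : 0 < a) {s : ℝ} (hs : 0 ≤ s) (g : ↥(fineDom n Ω) → ℝ) :
    g ⬝ᵥ (fineOpR n a 0 (fineDom n Ω)).mulVec g ≤ g ⬝ᵥ (regLine L hn Ω a s).mulVec g := by
  rw [← regLine_zero L hn a, regLine_form, regLine_form]
  exact twoCutoffLine_form_mono hn (fineReg_isBlockUnion L hn Ω) ha hs _

/-- the region line has unit determinant for `a > 0`, `s ≥ 0` (coercivity). [folklore] -/
theorem regLine_isUnit_det (hn : 1 ≤ n) {a : ℝ} (ha : 0 < a) {s : ℝ} (hs : 0 ≤ s) : IsUnit (regLine L hn Ω a s).det :=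
  isUnit_det_of_coercive _ (lt_min (by norm_num) ha) (regLine_coercive L hn ha hs)

/-- `T^Ω(s)·T^Ω(s)⁻¹ = 1`. [folklore] -/
theorem regLine_mul_inv (hn : 1 ≤ n) {a : ℝ} (ha : 0 < a) {s : ℝ} (hs : 0 ≤ s) :
    regLine L hn Ω a s * (regLine L hn Ω a s)⁻¹ = 1 :=
  Matrix.mul_nonsing_inv _ (regLine_isUnit_det L hn ha hs)

/-- the region line is symmetric. [folklore] -/
theorem regLine_isSymm (hn : 1 ≤ n) (a s : ℝ) : (regLine L hn Ω a s).IsSymm := by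
  unfold regLine
  rw [Matrix.reindex_apply]
  exact (twoCutoffLine_isSymm _ n a s).submatrix _

/-- its inverse is symmetric. [folklore] -/
theorem regLine_inv_isSymm (hn : 1 ≤ n) (a s : ℝ) : ((regLine L hn Ω a s)⁻¹).IsSymm :=
  (regLine_isSymm L hn a s).inv

/-- the Green form of the region line is nonnegative: `0 ≤ ⟨w, (T^Ω(s))⁻¹w⟩`. [folklore] -/
theorem regLine_inv_form_nonneg (hn : 1 ≤ n) {a : ℝ} (ha : 0 < a) {s : ℝ} (hs : 0 ≤ s) (w : ↥(fineDom n Ω) → ℝ) :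
    0 ≤ w ⬝ᵥ ((regLine L hn Ω a s)⁻¹).mulVec w := by
  set u := ((regLine L hn Ω a s)⁻¹).mulVec w with hu
  have hw : (regLine L hn Ω a s).mulVec u = w := by
    rw [hu, Matrix.mulVec_mulVec, regLine_mul_inv L hn ha hs, Matrix.one_mulVec]
  calc (0 : ℝ) ≤ u ⬝ᵥ (regLine L hn Ω a s).mulVec u := regLine_form_nonneg L hn ha hs u
    _ = w ⬝ᵥ u := by rw [hw, dotProduct_comm]

/-- the inverse transports along the reindexing. [folklore] -/
theorem regLine_inv_eq (hn : 1 ≤ n) (a s : ℝ) :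
    (regLine L hn Ω a s)⁻¹ = Matrix.reindex (regEquiv n L Ω) (regEquiv n L Ω)
      (twoCutoffLine (isBlockUnion_fine (fineReg_isBlockUnion L hn Ω)) n a s)⁻¹ := by
  rw [regLine, Matrix.inv_reindex]

/-- the Green form transports along the reindexing. [folklore] -/
theorem regLine_inv_form (hn : 1 ≤ n) (a s : ℝ) (g : ↥(fineDom n Ω) → ℝ) :
    g ⬝ᵥ ((regLine L hn Ω a s)⁻¹).mulVec g =
      (g ∘ regEquiv n L Ω) ⬝ᵥ ((twoCutoffLine (isBlockUnion_fine (fineReg_isBlockUnion L hn Ω)) n a s)⁻¹).mulVec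
        (g ∘ regEquiv n L Ω) := by
  rw [regLine_inv_eq]
  simp only [dotProduct, Matrix.mulVec, Matrix.reindex_apply, Matrix.submatrix_apply, Function.comp]
  rw [← Equiv.sum_comp (regEquiv n L Ω)]
  refine Finset.sum_congr rfl fun x _ => ?_
  rw [← Equiv.sum_comp (regEquiv n L Ω)]
  simp only [Equiv.symm_apply_apply]

/-- **THE INVERSE-ANTITONE LEVER**: `⟨g, (T^Ω(s))⁻¹ g⟩ ≤ ⟨g, G_j(Ω,0) g⟩` for every `s ≥ 0` (`G_j(Ω,0) = (fineOpR n a 0 (fineDom n Ω))⁻¹`)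
— the propagator of the line lies BELOW run A's (`NE7K1LinTwoRunMonotone.twoCutoff_inv_form_antitone` at `0 ≤ s`). [folklore] -/
theorem regLine_inv_form_le (hn : 1 ≤ n) {a : ℝ} (ha : 0 < a) {s : ℝ} (hs : 0 ≤ s) (g : ↥(fineDom n Ω) → ℝ) :
    g ⬝ᵥ ((regLine L hn Ω a s)⁻¹).mulVec g ≤ g ⬝ᵥ ((fineOpR n a 0 (fineDom n Ω))⁻¹).mulVec g := by
  rw [← regLine_zero L hn a, regLine_inv_form, regLine_inv_form]
  exact twoCutoff_inv_form_antitone hn (fineReg_isBlockUnion L hn Ω) ha le_rfl hs _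

end Line

/-! ### §2 The `L²` set-to-set bound and the block–block pairing bound of `(T^Ω(s))⁻¹` -/

section Decay

variable {n : ℕ} (L : ℕ) [NeZero L] {Ω : Finset (Fin (d + 1) → ℤ)}

/-- **B4 (2.30), FIRST PAIRING, FOR THE REGION LINE** (file 86 transported): for `a > 0`, `0 ≤ δ ≤ 1` in the mesh-free window
`2(2(d+1)(δL)² + a(e^δ − 1)) ≤ (min(2,a)∕L^{d+1})∕2`, `s ∈ [0,1]`, `T ≠ ∅`, `dist_η(S,T) ≥ ρ₀`, `supp g ⊆ T`:
`Σ_{x∈S}((T^Ω(s))⁻¹g)(x)² ≤ (2∕(min(2,a)∕L^{d+1}))²·e^{−2δρ₀}·Σ_x g(x)²` — every mesh, every `Ω`. [folklore] -/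
theorem regLine_inv_setDecay (hn : 1 ≤ n) {a δ : ℝ} (ha : 0 < a) (hδ0 : 0 ≤ δ) (hδ1 : δ ≤ 1)
    (hsmall : 2 * (2 * ((d : ℝ) + 1) * (δ * L) ^ 2 + a * (Real.exp δ - 1)) ≤ (min 2 a / (L : ℝ) ^ (d + 1)) / 2)
    {s : ℝ} (hs0 : 0 ≤ s) (hs1 : s ≤ 1) (S T : Finset ↥(fineDom n Ω)) (hT : T.Nonempty) (ρ₀ : ℝ)
    (hρ₀ : ∀ x ∈ S, ∀ t ∈ T, ρ₀ ≤ edistR n (fineDom n Ω) x t)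
    (g : ↥(fineDom n Ω) → ℝ) (hg : ∀ x, x ∉ T → g x = 0) :
    ∑ x ∈ S, ((regLine L hn Ω a s)⁻¹.mulVec g) x ^ 2 ≤
      (2 / (min 2 a / (L : ℝ) ^ (d + 1))) ^ 2 * Real.exp (-(2 * (δ * ρ₀))) * ∑ x, g x ^ 2 := by
  classical
  set e := regEquiv n L Ω with he
  have hmv : ∀ x, ((regLine L hn Ω a s)⁻¹.mulVec g) x =
      ((twoCutoffLine (isBlockUnion_fine (fineReg_isBlockUnion L hn Ω)) n a s)⁻¹.mulVec (g ∘ e)) (e.symm x) := by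
    intro x
    rw [regLine_inv_eq, reindex_mulVec_apply]
  have hT' : (T.map e.symm.toEmbedding).Nonempty := hT.map
  have hρ' : ∀ x' ∈ S.map e.symm.toEmbedding, ∀ t' ∈ T.map e.symm.toEmbedding,
      ρ₀ ≤ edistR n ((fineDom L (fineDom n Ω)).image (blk L)) x' t' := by
    intro x' hx' t' ht'
    obtain ⟨x, hx, rfl⟩ := Finset.mem_map.1 hx'
    obtain ⟨t, ht, rfl⟩ := Finset.mem_map.1 ht'
    exact hρ₀ x hx t ht
  have hg' : ∀ x', x' ∉ T.map e.symm.toEmbedding → (g ∘ e) x' = 0 := by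
    intro x' hx'
    refine hg (e x') fun h => hx' ?_
    exact Finset.mem_map.2 ⟨e x', h, by simp⟩
  have h := (twoCutoff_inv_setDecay hn (fineReg_isBlockUnion L hn Ω) ha hδ0 hδ1 hsmall hs0 hs1
    (S.map e.symm.toEmbedding) (T.map e.symm.toEmbedding) hT' ρ₀ hρ' (g ∘ e) hg').2
  rw [Finset.sum_map] at h
  have hg2 : ∑ x', (g ∘ e) x' ^ 2 = ∑ x, g x ^ 2 := Equiv.sum_comp e (fun x => g x ^ 2)
  rw [hg2] at h
  have hS : ∑ x ∈ S, ((regLine L hn Ω a s)⁻¹.mulVec g) x ^ 2 =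
      ∑ x ∈ S, ((twoCutoffLine (isBlockUnion_fine (fineReg_isBlockUnion L hn Ω)) n a s)⁻¹.mulVec (g ∘ e))
        (e.symm.toEmbedding x) ^ 2 := by
    refine Finset.sum_congr rfl fun x _ => ?_
    rw [hmv]
    rfl
  rw [hS]
  exact h

/-- **BLOCK–BLOCK PAIRINGS OF `(T^Ω(s))⁻¹` DECAY**, every finite `Ω^{(j)}`, every mesh, every `s ∈ [0,1]`:
`|Σ_{x∈B(y)}Σ_{x′∈B(y′)}(T^Ω(s))⁻¹(x,x′)| ≤ N·(2∕σ)·e^{δ}·e^{−δ|y − y′|_∞}` (`N = n^{d+1}`, `σ = min(2,a)∕L^{d+1}`) — b04's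
`blockPairing_bound` with the fine operator generalised to the line. [cite: CombesThomas1973, §II] [folklore] -/
theorem regLine_blockPairing_bound (hn : 1 ≤ n) {a δ : ℝ} (ha : 0 < a) (hδ0 : 0 ≤ δ) (hδ1 : δ ≤ 1)
    (hsmall : 2 * (2 * ((d : ℝ) + 1) * (δ * L) ^ 2 + a * (Real.exp δ - 1)) ≤ (min 2 a / (L : ℝ) ^ (d + 1)) / 2)
    {s : ℝ} (hs0 : 0 ≤ s) (hs1 : s ≤ 1) (y y' : ↥Ω) :
    |(indR n Ω * (regLine L hn Ω a s)⁻¹ * (indR n Ω)ᵀ) y y'|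
      ≤ (n : ℝ) ^ (d + 1) * (2 / (min 2 a / (L : ℝ) ^ (d + 1))) * Real.exp δ *
          Real.exp (-(δ * supNorm (y.1 - y'.1))) := by
  classical
  have hσ : 0 < min 2 a / (L : ℝ) ^ (d + 1) := by
    have hL0 : (0 : ℝ) < L := by exact_mod_cast (NeZero.one_le : 1 ≤ L)
    exact div_pos (lt_min (by norm_num) ha) (by positivity)
  set R := fineDom n Ω with hR
  set G := (regLine L hn Ω a s)⁻¹ with hG
  set g : ↥R → ℝ := fun x' => indR n Ω y' x' with hg
  set v : ↥R → ℝ := G.mulVec g with hv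
  set S := Finset.univ.filter (fun x : ↥R => blk n x.1 = y.1) with hS
  set T := Finset.univ.filter (fun x : ↥R => blk n x.1 = y'.1) with hT
  set N : ℝ := (n : ℝ) ^ (d + 1) with hN
  have hn0 : (0 : ℝ) < n := by exact_mod_cast hn
  have hN0 : 0 < N := by positivity
  set s₀ : ℝ := supNorm (y.1 - y'.1) with hs₀
  -- the entry is the sum of `v` over the block `S`
  have hentry : (indR n Ω * G * (indR n Ω)ᵀ) y y' = ∑ x ∈ S, v x := by
    have h1 : (indR n Ω * G * (indR n Ω)ᵀ) y y' = ∑ x, indR n Ω y x * v x := by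
      simp only [Matrix.mul_apply, Matrix.transpose_apply, Finset.sum_mul]
      rw [Finset.sum_comm]
      refine Finset.sum_congr rfl fun x _ => ?_
      simp only [hv, Matrix.mulVec, dotProduct, hg, Finset.mul_sum]
      exact Finset.sum_congr rfl fun x' _ => by ring
    rw [h1, hS, Finset.sum_filter]
    refine Finset.sum_congr rfl fun x _ => ?_
    simp only [indR, Matrix.of_apply, boole_mul]
  -- support of the source, nonempty target block
  have hg_supp : ∀ x, x ∉ T → g x = 0 := by
    intro x hx
    have hx' : ¬ blk n x.1 = y'.1 := by simpa [hT] using hx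
    simp [hg, indR, hx']
  have hT_ne : T.Nonempty := by
    refine ⟨⟨finePt n y'.1 (fun _ => ⟨0, by omega⟩), finePt_mem_fineDom hn y'.2 _⟩, ?_⟩
    simp [hT, blk_finePt hn]
  have hρ : ∀ x ∈ S, ∀ t ∈ T, s₀ - 1 ≤ edistR n R x t := by
    intro x hx t ht
    have hx' : blk n x.1 = y.1 := (Finset.mem_filter.1 hx).2
    have ht' : blk n t.1 = y'.1 := (Finset.mem_filter.1 ht).2
    have h := edistR_ge_supNorm_blk hn R x t
    rwa [hx', ht'] at h
  have hdec := regLine_inv_setDecay L hn ha hδ0 hδ1 hsmall hs0 hs1 S T hT_ne (s₀ - 1) hρ g hg_supp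
  -- `Σ g² = |T| = N`, `|S| = N`
  have hg2 : ∑ x, g x ^ 2 = N := by
    have h1 : ∀ x : ↥R, g x ^ 2 = if blk n x.1 = y'.1 then (1 : ℝ) else 0 := by
      intro x
      simp only [hg, indR, Matrix.of_apply]
      split_ifs <;> simp
    simp_rw [h1]
    rw [Finset.sum_boole]
    have : ((Finset.univ.filter (fun x : ↥R => blk n x.1 = y'.1)).card : ℝ) = N := by
      rw [hN, hR, card_filter_blkR hn Ω y']
      push_cast
      rfl
    simpa using this
  have hScard : (S.card : ℝ) = N := by
    rw [hS, hN, hR, card_filter_blkR hn Ω y]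
    push_cast
    rfl
  have hexp : Real.exp (-(2 * (δ * (s₀ - 1)))) = (Real.exp δ * Real.exp (-(δ * s₀))) ^ 2 := by
    rw [← Real.exp_add, sq, ← Real.exp_add]
    congr 1
    ring
  have hcs := sq_sum_le_card_mul_sum_sq (s := S) (f := v)
  have hsq : (∑ x ∈ S, v x) ^ 2 ≤ (N * (2 / (min 2 a / (L : ℝ) ^ (d + 1))) * Real.exp δ * Real.exp (-(δ * s₀))) ^ 2 := by
    calc (∑ x ∈ S, v x) ^ 2 ≤ (S.card : ℝ) * ∑ x ∈ S, v x ^ 2 := hcs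
      _ ≤ N * ((2 / (min 2 a / (L : ℝ) ^ (d + 1))) ^ 2 * Real.exp (-(2 * (δ * (s₀ - 1)))) * N) := by
          rw [hScard, ← hg2]
          exact mul_le_mul_of_nonneg_left hdec (by positivity)
      _ = (N * (2 / (min 2 a / (L : ℝ) ^ (d + 1))) * Real.exp δ * Real.exp (-(δ * s₀))) ^ 2 := by
          rw [hexp]
          ring
  rw [hentry]
  exact abs_le_of_sq_le_sq hsq (by positivity)

end Decay


/-! ### §3 The line's Combes–Thomas rate of a parameter window `a ∈ [a₋, a₊]` -/

/-- **THE LINE'S COMBES–THOMAS RATE OF THE WINDOW**: `δ₀ = min(1, (min(2,a₋)∕L^{d+1})∕(8(d+1)L² + 8|a₊|))`, admissible for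
file 86's window `2(2(d+1)(δ₀L)² + a(e^{δ₀} − 1)) ≤ (min(2,a)∕L^{d+1})∕2` at every `a ∈ [a₋, a₊]`. [folklore] -/
def lineRate (d L : ℕ) (amin aplus : ℝ) : ℝ :=
  min 1 ((min 2 amin / (L : ℝ) ^ (d + 1)) / (8 * ((d : ℝ) + 1) * (L : ℝ) ^ 2 + 8 * |aplus|))

/-- the rate is positive (`L ≥ 1`, `a₋ > 0`). [folklore] -/
theorem lineRate_pos (d : ℕ) {L : ℕ} (hL : 1 ≤ L) {amin : ℝ} (aplus : ℝ) (ha : 0 < amin) : 0 < lineRate d L amin aplus := by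
  unfold lineRate
  have hL0 : (0 : ℝ) < L := by exact_mod_cast hL
  have : 0 < min 2 amin := lt_min (by norm_num) ha
  exact lt_min one_pos (by positivity)

/-- the rate is at most one. [folklore] -/
theorem lineRate_le_one (d L : ℕ) (amin aplus : ℝ) : lineRate d L amin aplus ≤ 1 := min_le_left _ _

/-- the rate is admissible for file 86's window at every `a` of the parameter window. [folklore] -/
theorem lineRate_small (d : ℕ) {L : ℕ} (hL : 1 ≤ L) {amin aplus a : ℝ} (ha : 0 < amin) (h1 : amin ≤ a) (h2 : a ≤ aplus) :
    2 * (2 * ((d : ℝ) + 1) * (lineRate d L amin aplus * L) ^ 2 + a * (Real.exp (lineRate d L amin aplus) - 1))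
      ≤ (min 2 a / (L : ℝ) ^ (d + 1)) / 2 := by
  set δ := lineRate d L amin aplus with hδ
  have hL0 : (0 : ℝ) < L := by exact_mod_cast hL
  have hL1 : (1 : ℝ) ≤ L := by exact_mod_cast hL
  have hδ0 : 0 < δ := lineRate_pos d hL aplus ha
  have hδ1 : δ ≤ 1 := lineRate_le_one d L amin aplus
  have hD : 0 < 8 * ((d : ℝ) + 1) * (L : ℝ) ^ 2 + 8 * |aplus| := by positivity
  set σm : ℝ := min 2 amin / (L : ℝ) ^ (d + 1) with hσm
  have hσm0 : 0 < σm := div_pos (lt_min (by norm_num) ha) (by positivity)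
  have hδle : δ ≤ σm / (8 * ((d : ℝ) + 1) * (L : ℝ) ^ 2 + 8 * |aplus|) := min_le_right _ _
  have hδD : δ * (8 * ((d : ℝ) + 1) * (L : ℝ) ^ 2 + 8 * |aplus|) ≤ σm := (le_div_iff₀ hD).1 hδle
  have hexp : Real.exp δ - 1 ≤ 2 * δ := by
    have habs : |δ| ≤ 1 := by rw [abs_of_pos hδ0]; exact hδ1
    have h := Real.abs_exp_sub_one_le habs
    rw [abs_of_pos hδ0] at h
    exact (le_abs_self _).trans h
  have ha0 : 0 < a := lt_of_lt_of_le ha h1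
  have haabs : a ≤ |aplus| := h2.trans (le_abs_self _)
  have hsq : δ ^ 2 ≤ δ := by nlinarith
  have hmin : σm ≤ min 2 a / (L : ℝ) ^ (d + 1) :=
    div_le_div_of_nonneg_right (min_le_min le_rfl h1) (by positivity)
  have e1 : a * (Real.exp δ - 1) ≤ |aplus| * (2 * δ) := by
    calc a * (Real.exp δ - 1) ≤ a * (2 * δ) := mul_le_mul_of_nonneg_left hexp ha0.le
      _ ≤ |aplus| * (2 * δ) := mul_le_mul_of_nonneg_right haabs (by positivity)
  have e2 : 2 * ((d : ℝ) + 1) * (δ * L) ^ 2 ≤ 2 * ((d : ℝ) + 1) * (L : ℝ) ^ 2 * δ := by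
    rw [mul_pow]
    have : δ ^ 2 * (L : ℝ) ^ 2 ≤ δ * (L : ℝ) ^ 2 := mul_le_mul_of_nonneg_right hsq (by positivity)
    nlinarith [this]
  nlinarith [e1, e2, hδD, hmin]

end Summit.QuantumFields.BalabanUV.T4Continuum.NE7K1LinRegionLine
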